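import Summits.BirchSwinnertonDyer.BirchSwinnertonDyer.Theorems.EdixhovenFibreFiveSevenStarredOptimalManinUnitFiveSevenLocalFormulaOrdinaryCells
import HarnessLib

/-!
# Kato's explicit reciprocity FORMULA for the direct representation at the UNSTARRED (G)-ordinary cells `(5; III)`, `(7; II)`, `(7; IV)`
# — the ordinary capstone read for ANY ordinary numerology (route `EdixhovenFibreFiveSeven`, line `kato-lever`; seat `bsd-line-edix-p4` g31, width)

HONEST FRAMING. Three theorems (no definition, no named fact, no instance, no `sorry`); helper `--supports` the Manin cruxes CORNER
(stmt-BirchSwinnertonDyer-23883) / TDS57 (stmt-BirchSwinnertonDyer-22227), whose conditional closers of record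
(`…OptimalManinUnitFiveSevenOfReciprocityLaw`, `…KPResidueOfReciprocityLaw`, LEAD g19) still take Kato's explicit reciprocity law [REC-tower]
(`tatePairingPoint_eq_trace_expStar_log_tower`, cite-only) as a hypothesis at the UNSTARRED cells. Nothing is closed; no crux is proved; **BSD is not
proved by any of this.**

WHAT. The LOC@ord stub of K★ (`…LocalFormulaOrdinaryCells.stub_localFormulaOrdinaryCells`, p801055) is keyed to the three STARRED ordinary cells
`(5; III*), (7; IV*), (7; II*)`, but its two ingredients are generic: the ordinary capstone `ordinaryCapstone` USES NONE of its cell binders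
(`Addv`, no `Iₙ*`, `4 < ord_p Δ_min`, the cell table, `α`), and `…LocalFormulaOrdinaryCellsOfCapstone.localFormula_of_ordinary_numerology_of_capstone` /
`…OrdinaryCellsModels.exists_goodModelData_of_ordinary_numerology` (g29) are stated for ANY ordinary numerology `(e, k, m, n, r₄, r₆, t₄, t₆)` with
the pattern `r₄ = t₄ = 0 < t₆` at `5` (CM fibre `y² = x³ + a x`, `j̃ = 1728`) / `r₆ = t₆ = 0 < t₄` at `7` (`y² = x³ + b`, `j̃ = 0`). The unstarred
ordinary cells have the SAME fibres: `(5; III)` (`ord₅ Δ_min = 3`, `e = 4`) ↦ `(4; 1,1,2; 0,2; 0,1)`, `(7; II)` (`ord₇ Δ_min = 2`, `e = 6`) ↦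
`(6; 1,1,1; 2,0; 1,0)`, `(7; IV)` (`ord₇ Δ_min = 4`, `e = 3`) ↦ `(3; 1,2,2; 2,0; 2,0)` (all with `k = 1`; `e m = 4k + r₄`, `e n = 6k + r₆`, `3r₄ = e t₄`,
`2r₆ = e t₆`, `3m = ord_p Δ_min + t₄`, `2n = ord_p Δ_min + t₆`).

* ★★★ `ordinaryCapstone_of_numerology` — `ordinaryCapstone` with its decorative cell binders REMOVED: any prime `p ≠ 2`, any `W/ℚ`, any number field
  `K`, place `v′ ∋ p`, any `(e, r₄, r₆, t₄, t₆)`; proof verbatim ((N1″) `AinfRamTop.omegaPeriod_seqO_ne_zero_of_generator` at the height-one generator,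
  then `UnitRootReciprocityTransport.exists_const_tatePairingPoint_eq_neg_trace_of_omegaPeriod_ne_zero_unitRoot_transport`).
* ★★★ `localFormula_of_ordinary_numerology` — Kato's formula `⟨[η″], P′⟩ = Tr_{K_{v′}/ℚ_p}(c′ · exp*_{d″}(η″) · log_{ω′} P′)` (`∀ d″ ∃ c′`) for the
  DIRECT representation of a globally minimal `W/ℚ` over `K_{v′}`, `p ∈ {5, 7}`, `0 ≤ ord_p j`, ANY ordinary numerology — `hcap` DISCHARGED in
  `localFormula_of_ordinary_numerology_of_capstone`.
* ★★★ `localFormulaUnstarredOrdinaryCells` — the same keyed as a cell statement, binders parallel to `stub_localFormulaOrdinaryCells`: `p ∈ {5, 7}`,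
  additive at `p`, `E[p]` irreducible, no `Iₙ*` fibre at `p`, `ord_p Δ_min ≤ 4`, cell table `(5, 3) ↦ e = 4`, `(7, 2) ↦ e = 6`, `(7, 4) ↦ e = 3`, any
  `K ∋ α`, `α^e = p`, any `v′ ∋ p`, any compatible `ω′`, any alternating Weil tower, the Prop-1.2.3 binders handed over (`ord_p j ≥ 0` from «additive,
  no `Iₙ*`», `MemberManinUnitFiveSevenGlue.padicValRat_j_nonneg_of_forall_ne_Istar`).

NEXT (this seat): the REC body at the cyclotomic towers `ℚ_v ⊆ ℚ(ζ_m)_w` for these cells (`recTowerAt_cyclotomic_of_formula_over_ext` with the de Rham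
input `DeRhamAtFiveSeven.isDeRham_adicCompletion_rat_fiveSeven`), then CORNER / TDS57's ordinary cells ⟸ {modularity, P1-bar} through
`katoNeronBody_of_sl2NeronValuesBar_of_rangeAt`.

References: [Kato1993LNM1553] Ch. II Thm. 1.4.1 (3)–(4), Lemma 1.4.3–1.4.5, §1.2.4; [BlochKato1990] Prop. 3.8, Ex. 3.10.1, Example 3.11; [Tate1967] §4;
[Fontaine1982FormesDifferentielles] §5; [SilvermanAEC2009] III.1, VII.5.5, IV.4.4, V.4.1; [SilvermanATAEC1994] IV Table 4.1; [Serre1972] §1.11.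
-/

set_option autoImplicit false
-- single-conjunct summit: `Summit.BirchSwinnertonDyer.BirchSwinnertonDyer.…` repeats the name by design
set_option linter.dupNamespace false

noncomputable section

open Field Function ValuativeRel WittVector NumberField IsDedekindDomain Polynomial
open scoped NumberField Topology Classical NNReal
open Literature.NumberTheory.PAdicHodge Literature.NumberTheory.GaloisRepresentations
  Literature.NumberTheory.GaloisRepresentations.IsNonarchimedeanLocalField Literature.NumberTheory.GaloisRepresentations.LubinTate
  Literature.NumberTheory.GaloisCohomology Literature.NumberTheory.EllipticCurves Literature.NumberTheory.EllipticCurves.FormalGroupChart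
  Literature.NumberTheory.PAdicHodge.GaloisContinuity Literature.IUT.LogVolume Literature.RingTheory.FormalGroups
  Literature.AlgebraicGeometry.Resolution _root_.WeierstrassCurve
  Literature.NumberTheory.EllipticCurves.Rank1Residual Literature.NumberTheory.DiophantineGeometry Rat.HeightOneSpectrum
  Literature.NumberTheory.EllipticCurves.Kato2004
  Summit.BirchSwinnertonDyer.Rank1Residual Summit.BirchSwinnertonDyer.Rank1Residual.Additive
  Summit.BirchSwinnertonDyer.BirchSwinnertonDyer.Theorems
  Summit.BirchSwinnertonDyer.BirchSwinnertonDyer.Theorems.StarredOptimalManinUnitFiveSevenLocalFormulaOrdinaryCellsOfCapstone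

namespace Summit.BirchSwinnertonDyer.BirchSwinnertonDyer.Theorems.LocalFormulaUnstarredOrdinaryCells

/-! ## §1 The ordinary capstone for any ordinary numerology (cell binders removed) -/

set_option maxHeartbeats 3200000 in
/-- ★★★ **The ordinary capstone, generic.** `…LocalFormulaOrdinaryCells.ordinaryCapstone` (p801055) VERBATIM with the unused cell binders (`p ∈ {5, 7}`,
`Addv`, no `Iₙ*`, `4 < ord_p Δ_min`, the starred cell table, `α`, `α^e = p`) replaced by `p ≠ 2` and free exponents `(e, r₄, r₆, t₄, t₆)`: for any
`W/ℚ`, number field `K`, place `v′ ∋ p` with the packet keys, every good ordinary `𝒪_D`-model datum `(D, a, b, W_D = ⟨0,0,0,aϱ^{r₄},bϱ^{r₆}⟩, ψ₀, …)`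
with its reduction / CM-fibre data (`Δ ∈ 𝒪_Fˣ`, `A_p ≠ 0`, `[Xᵖ][p] ∈ 𝒪_ℂˣ`, `W_D ≡ E₀ (mod ϱ)`, `‖a_p(E₀)‖ = 1`, …) and every socket datum of `W` over
`F = K_{v′}`: at depth `N := e(D)`, for every `Γ_F`-equivariant `φ : (W ⊗ F)(F̄) ≃ E(F̄)` with Tate-module map, ONE `c ∈ F` gives
`⟨[η], P⟩_W = −Tr_{F/ℚ_p}(c_P · exp*_d(η) · c)` at every cocycle `η`, every `P ∈ W(F)` over a deep formal division tower, every admissible `c_P`.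
Proof: (N1″) at the generator of the height-one formal Tate module, then the unit-root frame along the transport (E3-ord).
[cite: Kato1993LNM1553, Ch. II Thm. 1.4.1 (3)–(4), Lemma 1.4.3] [cite: BlochKato1990, Ex. 3.10.1, Example 3.11] [cite: Tate1967, §4]
[cite: Fontaine1982FormesDifferentielles, §5] -/
theorem ordinaryCapstone_of_numerology (W : WeierstrassCurve ℚ) [W.IsElliptic] [W.IsGloballyMinimal] (p : ℕ) [Fact p.Prime]
    (hp2 : p ≠ 2)
    {K : Type} [Field K] [NumberField K] {e r₄ r₆ t₄ t₆ : ℕ}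
    (v' : HeightOneSpectrum (𝓞 K)) (_hv' : ((p : ℕ) : 𝓞 K) ∈ v'.asIdeal)
    [CharZero (v'.adicCompletion K)] [Fact (¬ IsUnit ((p : ℕ) : integerC (v'.adicCompletion K)))]
    [IsAdicComplete (Ideal.span {((p : ℕ) : integerC (v'.adicCompletion K))}) (integerC (v'.adicCompletion K))]
    (hp' : valuation (v'.adicCompletion K) ((p : ℕ) : (v'.adicCompletion K)) < 1)
    (ω' : Valuation (v'.adicCompletion K) ℝ≥0) [ω'.Compatible] [(W.baseChange (v'.adicCompletion K)).IsIntegral ω'.integer]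
    (eT : (k : ℕ) → geomTorsion W ((p ^ k : ℕ) : ℤ) → geomTorsion W ((p ^ k : ℕ) : ℤ) → AlgebraicClosure ℚ) (hμ : ∀ k S T, eT k S T ^ (p ^ k) = 1)
    (hadd₁ : ∀ k S₁ S₂ T, eT k (S₁ + S₂) T = eT k S₁ T * eT k S₂ T) (hadd₂ : ∀ k S T₁ T₂, eT k S (T₁ + T₂) = eT k S T₁ * eT k S T₂)
    (hgal : ∀ k (σ : absoluteGaloisGroup ℚ) (S T : geomTorsion W ((p ^ k : ℕ) : ℤ)), σ • eT k S T = eT k (σ • S) (σ • T))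
    (_hnondeg : ∀ k (T : geomTorsion W ((p ^ k : ℕ) : ℤ)), (∀ S, eT k S T = 1) → T = 0) (_halt : ∀ k (S : geomTorsion W ((p ^ k : ℕ) : ℤ)), eT k S S = 1)
    (hcompat : ∀ k (S T : geomTorsion W ((p ^ (k + 1) : ℕ) : ℤ)),
      eT k (torsionMulHom W (p ^ (k + 1)) (p ^ k) p (pow_succ p k).symm S) (torsionMulHom W (p ^ (k + 1)) (p ^ k) p (pow_succ p k).symm T) = eT (k + 1) S T ^ p)
    (_hinjK : letI := LocalField.adicCompletionPadicAlgebra v' p _hv'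
      (bdRPeriodRingData (F := (v'.adicCompletion K)) (p := p) hp').CupLogInjective (logCyclotomic p) (restrictedRationalTateRep W (v'.adicCompletion K) p))
    (_hdeK : letI := LocalField.adicCompletionPadicAlgebra v' p _hv'
      ∀ z : contOneCocycles (restrictedRationalTateRep W (v'.adicCompletion K) p).toTopRep,
        (bdRPeriodRingData (F := (v'.adicCompletion K)) (p := p) hp').HasDualExp (logCyclotomic p) (restrictedRationalTateRep W (v'.adicCompletion K) p) fun σ => z.1 σ)
    (_d'' : letI := LocalField.adicCompletionPadicAlgebra v' p _hv'
      (bdRPeriodRingData (F := (v'.adicCompletion K)) (p := p) hp').FilZeroLine (restrictedRationalTateRep W (v'.adicCompletion K) p)) :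
    letI := LocalField.padicAlgebra (v'.adicCompletion K) p hp'
    haveI : CharZero (CompletedAlgClosure (v'.adicCompletion K)) :=
      charZero_of_injective_algebraMap (algebraMap (v'.adicCompletion K) (CompletedAlgClosure (v'.adicCompletion K))).injective
    ∀ (D : EisensteinRoot (v'.adicCompletion K) p hp') (_hD : D.poly = X ^ e - C (p : ℤ_[p])) (a b : ℤ)
      (Wm : WeierstrassCurve (EisensteinRoot.CoeffDisc D)) (ψ₀ : EisensteinRoot.CoeffDisc D →+* LTCoeff (v'.adicCompletion K))
      (_hψ₀ : ∀ c, algebraMap (LTCoeff (v'.adicCompletion K)) (v'.adicCompletion K) (ψ₀ c) = EisensteinRoot.CoeffDisc.toF D c)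
      (_hWm : Wm = ⟨0, 0, 0, algebraMap ℤ (EisensteinRoot.CoeffDisc D) a * EisensteinRoot.CoeffDisc.of D (AdjoinRoot.root D.poly) ^ r₄,
        algebraMap ℤ (EisensteinRoot.CoeffDisc D) b * EisensteinRoot.CoeffDisc.of D (AdjoinRoot.root D.poly) ^ r₆⟩)
      (_hu : IsUnit (64 * (a : ℤ_[p]) ^ 3 * (p : ℤ_[p]) ^ t₄ + 432 * (b : ℤ_[p]) ^ 2 * (p : ℤ_[p]) ^ t₆))
      (_hΔ : IsUnit (Wm.map ψ₀).Δ) (_hA : ((Wm.map ψ₀).map (AinfTop.redCoeff (v'.adicCompletion K))).hasseCoeff p ≠ 0)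
      (_h1 : IsUnit (algebraMap (LTCoeff (v'.adicCompletion K)) (CBall (v'.adicCompletion K)) (PowerSeries.coeff p ((Wm.map ψ₀).formalMul p))))
      [(AinfTop.curveFO (v'.adicCompletion K) (Wm.map ψ₀)).IsElliptic]
      [(curveOver (CompletedAlgClosure (v'.adicCompletion K)) (Wm.map ψ₀)).IsElliptic]
      (E₀ : WeierstrassCurve ℤ) (_hE₀ : E₀ = ⟨0, 0, 0, if r₄ = 0 then a else 0, if r₆ = 0 then b else 0⟩)
      (_hWE : Wm.map (Ideal.Quotient.mk (Ideal.span {EisensteinRoot.CoeffDisc.of D (AdjoinRoot.root D.poly)})) =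
        (E₀.map (algebraMap ℤ (EisensteinRoot.CoeffDisc D))).map (Ideal.Quotient.mk (Ideal.span {EisensteinRoot.CoeffDisc.of D (AdjoinRoot.root D.poly)})))
      (_hΔ₀ : ¬ (p : ℤ) ∣ E₀.Δ) (_hA₀ : (E₀.map (Int.castRingHom (ZMod p))).hasseCoeff p ≠ 0)
      (_htr : ¬ (p : ℤ) ∣ HasseManin.tr (E₀.map (Int.castRingHom (ZMod p))))
      (_hnorm : ‖((HasseManin.tr (E₀.map (Int.castRingHom (ZMod p))) : ℤ) : ℤ_[p])‖ = 1)
      (_hsq : HasseManin.tr (E₀.map (Int.castRingHom (ZMod p))) ^ 2 < 4 * p)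
      [(E₀.map (Int.castRingHom ℚ_[p])).IsElliptic] [(E₀.map (Int.castRingHom (ZMod p))).IsElliptic]
      [(curveOver (CompletedAlgClosure (v'.adicCompletion K)) E₀).IsElliptic]
      -- socket data of `W` over `F`
      (ψ : C(absoluteGaloisGroup (v'.adicCompletion K), ℤ_[p])) (_hψ : ∀ σ τ, ψ (σ * τ) = ψ σ + ψ τ)
      (_hψlog : ∀ τ, (ψ τ : ℚ_[p]) = logCyclotomic (F := (v'.adicCompletion K)) p τ)
      (_heL : ∀ (c : ℤ_[p]) (S U : W.tateModule p),
        (weilContPairingPadic W (v'.adicCompletion K) p eT hμ hadd₁ hadd₂ hgal hcompat).toLin (c • S) U =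
        twistHom (v'.adicCompletion K) p ((weilContPairingPadic W (v'.adicCompletion K) p eT hμ hadd₁ hadd₂ hgal hcompat).toLin S U) c)
      (_healt : ∀ S : W.tateModule p, (weilContPairingPadic W (v'.adicCompletion K) p eT hμ hadd₁ hadd₂ hgal hcompat).toLin S S = 0)
      (_henondeg : ∀ S : W.tateModule p,
        (∀ U, (weilContPairingPadic W (v'.adicCompletion K) p eT hμ hadd₁ hadd₂ hgal hcompat).toLin S U = 0) → S = 0)
      (_hinj : (bdRPeriodRingData (F := (v'.adicCompletion K)) (p := p) hp').CupLogInjective (logCyclotomic p)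
        (restrictedRationalTateRep W (v'.adicCompletion K) p))
      (_hde : ∀ η : contOneCocycles (restrictedTateRep W (v'.adicCompletion K) p).toTopRep,
        (bdRPeriodRingData (F := (v'.adicCompletion K)) (p := p) hp').HasDualExp (logCyclotomic p)
          (restrictedRationalTateRep W (v'.adicCompletion K) p) fun σ => TateModule.toRational p (η.1 σ))
      (d : (bdRPeriodRingData (F := (v'.adicCompletion K)) (p := p) hp').FilZeroLine (restrictedRationalTateRep W (v'.adicCompletion K) p))
      -- a depth `N ≥ 1`, then: the transport isomorphism onto the model and its Tate-module map
      , ∃ N : ℕ, N ≠ 0 ∧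
    ∀ (φ : geomPoints (W.baseChange (v'.adicCompletion K)) ≃+ (AinfTop.curveFO (v'.adicCompletion K) (Wm.map ψ₀)).geomPoints)
      (_hφ : ∀ (σ : absoluteGaloisGroup (v'.adicCompletion K)) (P : geomPoints (W.baseChange (v'.adicCompletion K))), φ (σ • P) = σ • φ P)
      (Tφ : (W.baseChange (v'.adicCompletion K)).tateModule p ≃ₗ[ℤ_[p]] (AinfTop.curveFO (v'.adicCompletion K) (Wm.map ψ₀)).tateModule p)
      (_hTφ : ∀ (a : (W.baseChange (v'.adicCompletion K)).tateModule p) (n : ℕ), TateModule.proj p n (Tφ a) = φ (TateModule.proj p n a)),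
    ∃ c : v'.adicCompletion K,
    ∀ (η : contOneCocycles (restrictedTateRep W (v'.adicCompletion K) p).toTopRep)
      (P : (W.baseChange (v'.adicCompletion K)).toAffine.Point)
      (Q : ℕ → geomPoints (W.baseChange (v'.adicCompletion K)))
      (_hQ : ∀ n, p • Q (n + 1) = Q n)
      (_hQ0 : Q 0 = toGeomPoints (W.baseChange (v'.adicCompletion K)) P)
      (hker : ∀ n, AinfTop.geomToCO (Wm.map ψ₀) ((⇑φ ∘ Q) n) ∈ kernel (NormedField.valuation (K := CompletedAlgClosure (v'.adicCompletion K)))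
        (curveOver (CompletedAlgClosure (v'.adicCompletion K)) (Wm.map ψ₀))),
      ‖((zPt (AinfTop.geomToCO (Wm.map ψ₀) ((⇑φ ∘ Q) 0)) (hker 0) : CBall (v'.adicCompletion K)) : CompletedAlgClosure (v'.adicCompletion K))‖ ^ N ≤
          ‖(p : CompletedAlgClosure (v'.adicCompletion K))‖ →
      ∀ cP : v'.adicCompletion K,
        algebraMap (v'.adicCompletion K) (CompletedAlgClosure (v'.adicCompletion K)) cP =
          (p : CompletedAlgClosure (v'.adicCompletion K)) ^ N *
            ∑' j : ℕ, PowerSeries.coeff j (Wm.map ((CBall (v'.adicCompletion K)).subtype.comp (EisensteinRoot.CoeffDisc.toCBall D))).formalLog *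
              ((zPt (AinfTop.geomToCO (Wm.map ψ₀) ((⇑φ ∘ Q) 0)) (hker 0) : CBall (v'.adicCompletion K)) : CompletedAlgClosure (v'.adicCompletion K)) ^ j →
        ((tatePairingPoint W (v'.adicCompletion K) p eT hμ hadd₁ hadd₂ hgal hcompat (oneCocycleClass _ η) P : ℤ_[p]) : ℚ_[p]) =
          -Algebra.trace ℚ_[p] (v'.adicCompletion K) (cP * (expStarCoord W hp' d η * c)) := by
  letI := LocalField.padicAlgebra (v'.adicCompletion K) p hp'
  haveI : CharZero (CompletedAlgClosure (v'.adicCompletion K)) :=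
    charZero_of_injective_algebraMap (algebraMap (v'.adicCompletion K) (CompletedAlgClosure (v'.adicCompletion K))).injective
  haveI : CharP 𝓀[v'.adicCompletion K] p := StarredOptimalManinUnitFiveSevenSupersingularCellsModels.charP_residueField_of_valuation_lt_one hp'
  intro D _hD a b Wm ψ₀ hψ₀ _hWm _hu hΔ _hA h1 _ _ E₀ _hE₀ hWE _hΔ₀ _hA₀ _htr hnorm _hsq _ _ _ ψ hψ hψlog heL healt henondeg
    hinj hde d
  refine ⟨D.e, D.e_pos.ne', fun φ hφ Tφ hTφ => ?_⟩
  -- (N1″) at the generator `v₀` of the height-one formal Tate module (LEAD edix-p1 g32), in the `𝒪_D`-currency of `[Xᵖ][p]`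
  have hunit : IsUnit (algebraMap (EisensteinRoot.CoeffDisc D) (CBall (v'.adicCompletion K)) (PowerSeries.coeff p (Wm.formalMul p))) := by
    rw [← AinfRamTop.algebraMap_ψ_eq ψ₀ hψ₀, ← PowerSeries.coeff_map, WeierstrassCurve.map_formalMul]
    exact h1
  obtain ⟨v₀, hv₀, hgen, -⟩ := exists_generator_tatePtO_of_isUnit (norm_natCast_C_lt_one hp') (Wm.map ψ₀) h1
  have hN1' : ∃ τ : AinfTop.TatePtO (v'.adicCompletion K) (Wm.map ψ₀) p,
      AinfRamTop.omegaPeriod Wm (surjective_fontaineTheta_integerC hp') (AinfTop.seqO (Wm.map ψ₀) τ) (AinfTop.seqO_zero (Wm.map ψ₀) τ)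
        (AinfRamTop.mulPC_seqO Wm ψ₀ hψ₀ τ) ≠ 0 :=
    ⟨v₀, AinfRamTop.omegaPeriod_seqO_ne_zero_of_generator Wm ψ₀ hψ₀ hunit hv₀ hgen⟩
  -- the unit-root frame along `φ`, from the cells' data and (N1′) (this seat, E3-ord)
  -- (STEPWISE application: a one-shot application of this many-binder theorem is slow to elaborate)
  have hE1 := UnitRootReciprocityTransport.exists_const_tatePairingPoint_eq_neg_trace_of_omegaPeriod_ne_zero_unitRoot_transport v' hp' D Wm ψ₀ hψ₀
    hp2 hΔ h1 W φ hφ Tφ hTφ eT hμ hadd₁ hadd₂ hgal hcompat E₀ hWE hnorm (N := D.e) le_rfl hN1'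
  have hE2 := hE1 ψ hψ hψlog heL healt henondeg
  exact hE2 hinj hde d

/-! ## §2 Kato's formula for the direct representation, any ordinary numerology — `hcap` discharged -/

section Numerology

variable (W : WeierstrassCurve ℚ) [W.IsElliptic] [W.IsGloballyMinimal] (p : ℕ) [hp : Fact p.Prime]

set_option maxHeartbeats 1600000 in
/-- ★★★ **Kato's explicit reciprocity formula for the DIRECT representation of `W` over `K_{v′}`, ANY ordinary numerology, UNCONDITIONALLY.** For `W/ℚ`
globally minimal, `p ∈ {5, 7}`, `0 ≤ ord_p j(W)`, an ordinary numerology `(e, k, m, n, r₄, r₆, t₄, t₆)` (`e m = 4k + r₄`, `e n = 6k + r₆`, `3r₄ = e t₄`,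
`2r₆ = e t₆`, `3m = ord_p Δ_min + t₄`, `2n = ord_p Δ_min + t₆`, `t₄ ≤ 2`, `t₆ ≤ 1`, `r₄ = t₄ = 0 < t₆` at `5`, `r₆ = t₆ = 0 < t₄` at `7`), a number field
`K ∋ α` with `α^e = p`, a place `v′ ∋ p` with the packet keys, a compatible `ω′` with `W ⊗ K_{v′}` integral, an alternating Weil tower of `W` and the
Prop-1.2.3 binders: for every line datum `d″` SOME `c′ ∈ K_{v′}` with `⟨[η″], P′⟩ = Tr_{K_{v′}/ℚ_p}(c′ · exp*_{d″}(η″) · log_{ω′} P′)` for all `η″`, `P′`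
(`localFormula_of_ordinary_numerology_of_capstone` ∘ `ordinaryCapstone_of_numerology`). [cite: Kato1993LNM1553, Ch. II Thm. 1.4.1 (3)–(4), Lemma 1.4.3–1.4.5 and §1.2.4]
[cite: BlochKato1990, Prop. 3.8 (p. 354), Example 3.11 (p. 361)] [cite: SilvermanAEC2009, III.1, Prop. III.8.1, VII.5.5, IV.4.4 and V.4.1] -/
theorem localFormula_of_ordinary_numerology (hp57 : p = 5 ∨ p = 7) (hj : 0 ≤ padicValRat p W.j)
    {e k m n r₄ r₆ t₄ t₆ : ℕ} (he : 0 < e) (hem : e * m = 4 * k + r₄) (hen : e * n = 6 * k + r₆)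
    (h₄ : 3 * r₄ = e * t₄) (h₆ : 2 * r₆ = e * t₆)
    (hm : 3 * m = padicValInt p W.minimalDiscriminantInt + t₄) (hn : 2 * n = padicValInt p W.minimalDiscriminantInt + t₆)
    (ht₄ : t₄ ≤ 2) (ht₆ : t₆ ≤ 1) (h5 : p = 5 → r₄ = 0 ∧ t₄ = 0 ∧ 0 < t₆) (h7 : p = 7 → r₆ = 0 ∧ t₆ = 0 ∧ 0 < t₄)
    {K : Type} [Field K] [NumberField K] {α : K} (hαe : α ^ e = (p : K))
    (v' : HeightOneSpectrum (𝓞 K)) (hv' : ((p : ℕ) : 𝓞 K) ∈ v'.asIdeal)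
    [CharZero (v'.adicCompletion K)] [Fact (¬ IsUnit ((p : ℕ) : integerC (v'.adicCompletion K)))]
    [IsAdicComplete (Ideal.span {((p : ℕ) : integerC (v'.adicCompletion K))}) (integerC (v'.adicCompletion K))]
    (hp' : valuation (v'.adicCompletion K) ((p : ℕ) : (v'.adicCompletion K)) < 1)
    (ω' : Valuation (v'.adicCompletion K) ℝ≥0) [ω'.Compatible] [(W.baseChange (v'.adicCompletion K)).IsIntegral ω'.integer]
    (eT : (k : ℕ) → geomTorsion W ((p ^ k : ℕ) : ℤ) → geomTorsion W ((p ^ k : ℕ) : ℤ) → AlgebraicClosure ℚ) (hμ : ∀ k S T, eT k S T ^ (p ^ k) = 1)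
    (hadd₁ : ∀ k S₁ S₂ T, eT k (S₁ + S₂) T = eT k S₁ T * eT k S₂ T) (hadd₂ : ∀ k S T₁ T₂, eT k S (T₁ + T₂) = eT k S T₁ * eT k S T₂)
    (hgal : ∀ k (σ : absoluteGaloisGroup ℚ) (S T : geomTorsion W ((p ^ k : ℕ) : ℤ)), σ • eT k S T = eT k (σ • S) (σ • T))
    (hnondeg : ∀ k (T : geomTorsion W ((p ^ k : ℕ) : ℤ)), (∀ S, eT k S T = 1) → T = 0) (halt : ∀ k (S : geomTorsion W ((p ^ k : ℕ) : ℤ)), eT k S S = 1)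
    (hcompat : ∀ k (S T : geomTorsion W ((p ^ (k + 1) : ℕ) : ℤ)),
      eT k (torsionMulHom W (p ^ (k + 1)) (p ^ k) p (pow_succ p k).symm S) (torsionMulHom W (p ^ (k + 1)) (p ^ k) p (pow_succ p k).symm T) = eT (k + 1) S T ^ p)
    (hinjK : letI := LocalField.adicCompletionPadicAlgebra v' p hv'
      (bdRPeriodRingData (F := (v'.adicCompletion K)) (p := p) hp').CupLogInjective (logCyclotomic p) (restrictedRationalTateRep W (v'.adicCompletion K) p))
    (hdeK : letI := LocalField.adicCompletionPadicAlgebra v' p hv'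
      ∀ z : contOneCocycles (restrictedRationalTateRep W (v'.adicCompletion K) p).toTopRep,
        (bdRPeriodRingData (F := (v'.adicCompletion K)) (p := p) hp').HasDualExp (logCyclotomic p) (restrictedRationalTateRep W (v'.adicCompletion K) p) fun σ => z.1 σ)
    (d'' : letI := LocalField.adicCompletionPadicAlgebra v' p hv'
      (bdRPeriodRingData (F := (v'.adicCompletion K)) (p := p) hp').FilZeroLine (restrictedRationalTateRep W (v'.adicCompletion K) p)) :
    letI := LocalField.adicCompletionPadicAlgebra v' p hv'
    ∃ c' : (v'.adicCompletion K),
      ∀ (η'' : contOneCocycles (restrictedTateRep W (v'.adicCompletion K) p).toTopRep) (P' : (W.baseChange (v'.adicCompletion K)).toAffine.Point),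
      ((tatePairingPoint W (v'.adicCompletion K) p eT hμ hadd₁ hadd₂ hgal hcompat (oneCocycleClass _ η'') P' : ℤ_[p]) : ℚ_[p]) =
        Algebra.trace ℚ_[p] (v'.adicCompletion K) (c' * expStarCoord W hp' d'' η'' * padicLogPointFiniteExt ω' (W.baseChange (v'.adicCompletion K)) p P') :=
  localFormula_of_ordinary_numerology_of_capstone W p hp57 hj he hem hen h₄ h₆ hm hn ht₄ ht₆ h5 h7 hαe v' hv' hp' ω' eT hμ hadd₁ hadd₂ hgal
    hnondeg halt hcompat hinjK hdeK d''
    (ordinaryCapstone_of_numerology W p (by rintro rfl; rcases hp57 with h | h <;> omega) v' hv' hp' ω' eT hμ hadd₁ hadd₂ hgal hnondeg halt hcompat hinjK hdeK d'')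

end Numerology

/-! ## §3 The three UNSTARRED (G)-ordinary cells at `p ∈ {5, 7}` -/

set_option maxHeartbeats 1600000 in
/-- ★★★ **Kato's explicit reciprocity FORMULA at the UNSTARRED (G)-ordinary cells `(5; III)`, `(7; II)`, `(7; IV)`** — `⟨[η″], P′⟩ =
Tr_{K_{v′}/ℚ_p}(c′ · exp*_{d″}(η″) · log_{ω′} P′)` (`∀ d″ ∃ c′`) for the DIRECT representation `V_pW′|_{Γ_{K_{v′}}}` of every globally minimal `W′/ℚ` with
`p ∈ {5, 7}`, additive reduction at `p`, `E[p]` irreducible, no `Iₙ*` fibre at `p`, `ord_p Δ_min ≤ 4`, on the cell table `(5, ord = 3) ↦ e = 4`,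
`(7, ord = 2) ↦ e = 6`, `(7, ord = 4) ↦ e = 3` (Kodaira III at `5`, II and IV at `7`: `j̃ ∈ {1728, 0}`, ORDINARY), over the completion `K_{v′}` of ANY
number field `K ∋ α`, `α^e = p`, at ANY place `v′ ∋ p`, for every compatible `ω′`, every alternating Weil tower and the Prop-1.2.3 binders — the binder
shape of `stub_localFormulaOrdinaryCells` with the starred conditions replaced by the unstarred ones. Numerology `(4; 1,1,2; 0,2; 0,1)`,
`(6; 1,1,1; 2,0; 1,0)`, `(3; 1,2,2; 2,0; 2,0)`; `0 ≤ ord_p j` by `MemberManinUnitFiveSevenGlue.padicValRat_j_nonneg_of_forall_ne_Istar`.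
[cite: Kato1993LNM1553, Ch. II Thm. 1.4.1 (3)–(4), Lemma 1.4.3–1.4.5 and §1.2.4] [cite: SilvermanATAEC1994, IV Table 4.1]
[cite: SilvermanAEC2009, VII.5.5, IV.4.4 and V.4.1] -/
theorem localFormulaUnstarredOrdinaryCells :
    ∀ (W' : WeierstrassCurve ℚ) [W'.IsElliptic] [W'.IsGloballyMinimal] (p : ℕ) [Fact p.Prime], (p = 5 ∨ p = 7) → Addv W' p → Irr W' p →
      (∀ (v : HeightOneSpectrum ℤ) (n : ℕ), natGenerator v = p → W'.kodairaSymbolAt v ≠ KodairaSymbol.Istar n) →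
      padicValInt p W'.minimalDiscriminantInt ≤ 4 →
      ∀ {K : Type} [Field K] [NumberField K] (α : K) (e : ℕ),
      (p = 5 ∧ padicValInt p W'.minimalDiscriminantInt = 3 ∧ e = 4 ∨ p = 7 ∧ padicValInt p W'.minimalDiscriminantInt = 2 ∧ e = 6 ∨
        p = 7 ∧ padicValInt p W'.minimalDiscriminantInt = 4 ∧ e = 3) → α ^ e = (p : K) →
      ∀ (v' : HeightOneSpectrum (𝓞 K)) (hv' : ((p : ℕ) : 𝓞 K) ∈ v'.asIdeal)
      [CharZero (v'.adicCompletion K)] [Fact (¬ IsUnit ((p : ℕ) : integerC (v'.adicCompletion K)))]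
      [IsAdicComplete (Ideal.span {((p : ℕ) : integerC (v'.adicCompletion K))}) (integerC (v'.adicCompletion K))]
      (hp' : valuation (v'.adicCompletion K) ((p : ℕ) : (v'.adicCompletion K)) < 1)
      (ω' : Valuation (v'.adicCompletion K) ℝ≥0) [ω'.Compatible] [(W'.baseChange (v'.adicCompletion K)).IsIntegral ω'.integer],
      letI := LocalField.adicCompletionPadicAlgebra v' p hv'
      ∀ (e : (k : ℕ) → geomTorsion W' ((p ^ k : ℕ) : ℤ) → geomTorsion W' ((p ^ k : ℕ) : ℤ) → AlgebraicClosure ℚ) (hμ : ∀ k S T, e k S T ^ (p ^ k) = 1)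
      (hadd₁ : ∀ k S₁ S₂ T, e k (S₁ + S₂) T = e k S₁ T * e k S₂ T) (hadd₂ : ∀ k S T₁ T₂, e k S (T₁ + T₂) = e k S T₁ * e k S T₂)
      (hgal : ∀ k (σ : absoluteGaloisGroup ℚ) (S T : geomTorsion W' ((p ^ k : ℕ) : ℤ)), σ • e k S T = e k (σ • S) (σ • T))
      (_hnondeg : ∀ k (T : geomTorsion W' ((p ^ k : ℕ) : ℤ)), (∀ S, e k S T = 1) → T = 0) (_halt : ∀ k (S : geomTorsion W' ((p ^ k : ℕ) : ℤ)), e k S S = 1)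
      (hcompat : ∀ k (S T : geomTorsion W' ((p ^ (k + 1) : ℕ) : ℤ)),
      e k (torsionMulHom W' (p ^ (k + 1)) (p ^ k) p (pow_succ p k).symm S) (torsionMulHom W' (p ^ (k + 1)) (p ^ k) p (pow_succ p k).symm T) = e (k + 1) S T ^ p),
      (bdRPeriodRingData (F := (v'.adicCompletion K)) (p := p) hp').CupLogInjective (logCyclotomic p) (restrictedRationalTateRep W' (v'.adicCompletion K) p) →
      (∀ z : contOneCocycles (restrictedRationalTateRep W' (v'.adicCompletion K) p).toTopRep,
        (bdRPeriodRingData (F := (v'.adicCompletion K)) (p := p) hp').HasDualExp (logCyclotomic p) (restrictedRationalTateRep W' (v'.adicCompletion K) p) fun σ => z.1 σ) →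
      ∀ d'' : (bdRPeriodRingData (F := (v'.adicCompletion K)) (p := p) hp').FilZeroLine (restrictedRationalTateRep W' (v'.adicCompletion K) p), ∃ c' : (v'.adicCompletion K),
      ∀ (η'' : contOneCocycles (restrictedTateRep W' (v'.adicCompletion K) p).toTopRep) (P' : (W'.baseChange (v'.adicCompletion K)).toAffine.Point),
      ((tatePairingPoint W' (v'.adicCompletion K) p e hμ hadd₁ hadd₂ hgal hcompat (oneCocycleClass _ η'') P' : ℤ_[p]) : ℚ_[p]) =
        Algebra.trace ℚ_[p] (v'.adicCompletion K) (c' * expStarCoord W' hp' d'' η'' * padicLogPointFiniteExt ω' (W'.baseChange (v'.adicCompletion K)) p P') := by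
  intro W' _ _ p _ hp57 hadd _hirr hIstar _h4 K _ _ α e htab hαe v' hv' _ _ _ hp' ω' _ _ eT hμ hadd₁ hadd₂ hgal hnondeg halt hcompat hinjK hdeK d''
  have hp2 : p ≠ 2 := fun h => by rcases hp57 with h5 | h7 <;> omega
  have hj : 0 ≤ padicValRat p W'.j :=
    Summit.BirchSwinnertonDyer.BirchSwinnertonDyer.Theorems.MemberManinUnitFiveSevenGlue.padicValRat_j_nonneg_of_forall_ne_Istar W' hp2 hadd hIstar
  rcases htab with ⟨rfl, h3, rfl⟩ | ⟨rfl, h2, rfl⟩ | ⟨rfl, h4, rfl⟩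
  · -- `(5; III)`: `j̃ = 1728`, numerology `(4; 1,1,2; 0,2; 0,1)`
    exact localFormula_of_ordinary_numerology W' 5 (Or.inl rfl) hj (e := 4) (k := 1) (m := 1) (n := 2) (r₄ := 0) (r₆ := 2) (t₄ := 0) (t₆ := 1)
      (by norm_num) (by norm_num) (by norm_num) (by norm_num) (by norm_num) (by rw [h3]) (by rw [h3]) (by norm_num) (by norm_num)
      (fun _ => ⟨rfl, rfl, by norm_num⟩) (fun h => by norm_num at h) hαe v' hv' hp' ω' eT hμ hadd₁ hadd₂ hgal hnondeg halt hcompat hinjK hdeK d''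
  · -- `(7; II)`: `j̃ = 0`, numerology `(6; 1,1,1; 2,0; 1,0)`
    exact localFormula_of_ordinary_numerology W' 7 (Or.inr rfl) hj (e := 6) (k := 1) (m := 1) (n := 1) (r₄ := 2) (r₆ := 0) (t₄ := 1) (t₆ := 0)
      (by norm_num) (by norm_num) (by norm_num) (by norm_num) (by norm_num) (by rw [h2]) (by rw [h2]) (by norm_num) (by norm_num)
      (fun h => by norm_num at h) (fun _ => ⟨rfl, rfl, by norm_num⟩) hαe v' hv' hp' ω' eT hμ hadd₁ hadd₂ hgal hnondeg halt hcompat hinjK hdeK d''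
  · -- `(7; IV)`: `j̃ = 0`, numerology `(3; 1,2,2; 2,0; 2,0)`
    exact localFormula_of_ordinary_numerology W' 7 (Or.inr rfl) hj (e := 3) (k := 1) (m := 2) (n := 2) (r₄ := 2) (r₆ := 0) (t₄ := 2) (t₆ := 0)
      (by norm_num) (by norm_num) (by norm_num) (by norm_num) (by norm_num) (by rw [h4]) (by rw [h4]) (by norm_num) (by norm_num)
      (fun h => by norm_num at h) (fun _ => ⟨rfl, rfl, by norm_num⟩) hαe v' hv' hp' ω' eT hμ hadd₁ hadd₂ hgal hnondeg halt hcompat hinjK hdeK d''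

end Summit.BirchSwinnertonDyer.BirchSwinnertonDyer.Theorems.LocalFormulaUnstarredOrdinaryCells

end
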